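import Mathlib
import HarnessLib
import Summits.KontsevichZagierPeriods.KontsevichZagierPeriods.Theses.LinRedNormalForm
import Summits.KontsevichZagierPeriods.KontsevichZagierPeriods.Theorems.LinRedNormalFormDihedralNormalFormStubAtomReductionAux5
import Summits.KontsevichZagierPeriods.KontsevichZagierPeriods.Theorems.LinRedNormalFormDihedralNormalFormStubAtomConvergence

/-!
# Stub `stub_monomialConvergence` (line `torus-descent-sum-shadow`, crux `DihedralNormalForm`):
Brown's convergence criterion on the open ordered simplex (sufficiency)

A simplicial Laurent monomial `q · ∏ᵢ tᵢ^{βᵢ} (1 - tᵢ)^{γᵢ} ∏_{i<j} (tᵢ - tⱼ)^{αᵢⱼ}` is absolutely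
integrable on `Δ_k = {1 > t₀ > ⋯ > t_{k-1} > 0}` as soon as the three families of block
inequalities hold (inner blocks `{tᵢ, …, tⱼ}`, blocks through `1`, blocks through `0`).

Proof: transport through the cubical chart `tᵢ = x₀ ⋯ xᵢ` of the simplex
(`AtomReduction.integrableOn_simplex_iff`, Jacobian `∏ⱼ xⱼ^{k-1-j}`). Since
`tₗ = x₀ ⋯ xₗ`, `1 - tₗ = 1 - x₀ ⋯ xₗ` and `tₗ - tₗ' = tₗ (1 - x_{l+1} ⋯ x_{l'})`, the pulled-back
integrand times the Jacobian is the cubical atom `xᵃ · ∏_{i ≤ j} (1 - xᵢ ⋯ xⱼ)^{e i j}` with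
`e 0 j = γⱼ`, `e (i+1) j = αᵢⱼ` and
`aₘ = ∑_{l ≥ m} βₗ + ∑_{m ≤ l < l'} α_{l l'} + (k - 1 - m)` (`pullback_eq`); the blocks through `0`
say exactly `aₘ ≥ 0`, and the two other families are exactly the interval conditions of the
landed cubical criterion `atomConvergence` (`interval_condition`).

Reference: F. Brown, *Multiple zeta values and periods of moduli spaces `𝔐_{0,n}`*, Ann. Sci. ENS
(2009), §7 (Lemma 7.2); only the sufficiency of the criterion is proved here.
-/

noncomputable section

open MeasureTheory Set

namespace Summit.KontsevichZagierPeriods.DihedralNormalForm.TorusDescent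

namespace MonomialConvergence

open Summit.KontsevichZagierPeriods.MzvKernelInKZ
open Summit.KontsevichZagierPeriods.DihedralNormalForm.TorusDescent.AtomReduction

variable {n : ℕ}

/-- **Interval conditions.** The block inequalities through `1` and the inner block inequalities
of the simplicial exponents `(γ, α)` are the interval conditions of the cubical exponent matrix
`e` (`e 0 j = γ j`, `e (i+1) j = α i j`). -/
theorem interval_condition (γ : Fin (n + 1) → ℤ) (α e : Fin (n + 1) → Fin (n + 1) → ℤ)
    (he0 : ∀ j, e 0 j = γ j) (hes : ∀ (i : Fin n) (j : Fin (n + 1)), e i.succ j = α i.castSucc j)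
    (h1 : ∀ i j : Fin (n + 1), i < j → 0 ≤ (∑ a : Fin (n + 1), ∑ b : Fin (n + 1),
      if i ≤ a ∧ a < b ∧ b ≤ j then α a b else 0) + ((j : ℤ) - (i : ℤ) + 1) - 2)
    (h2 : ∀ j : Fin (n + 1), 0 ≤ (∑ a : Fin (n + 1), if a ≤ j then γ a else 0) +
      (∑ a : Fin (n + 1), ∑ b : Fin (n + 1), if a < b ∧ b ≤ j then α a b else 0) +
        ((j : ℤ) + 1) - 1) :
    ∀ i j : Fin (n + 1), i ≤ j → 0 ≤ ((j : ℤ) - (i : ℤ)) +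
      ∑ i' : Fin (n + 1), ∑ j' : Fin (n + 1),
        if i ≤ i' ∧ i' ≤ j' ∧ j' ≤ j then e i' j' else 0 := by
  intro i j hij
  rw [Fin.sum_univ_succ]
  -- the last row of an `α`-sum over `a < b` vanishes
  have hlast : ∀ (c : Fin (n + 1) → Fin (n + 1) → Prop) [∀ a b, Decidable (c a b)],
      (∑ b : Fin (n + 1), if Fin.last n < b ∧ c (Fin.last n) b then α (Fin.last n) b else 0) = 0 :=
    fun c _ => Finset.sum_eq_zero fun b _ => if_neg fun h => (not_lt.2 (Fin.le_last b)) h.1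
  cases i using Fin.cases with
  | zero =>
    have h := h2 j
    have hsum0 : (∑ j' : Fin (n + 1),
        if (0 : Fin (n + 1)) ≤ 0 ∧ 0 ≤ j' ∧ j' ≤ j then e 0 j' else 0) =
        ∑ a : Fin (n + 1), if a ≤ j then γ a else 0 := by
      refine Finset.sum_congr rfl fun j' _ => ?_
      rw [he0]
      exact if_congr ⟨fun h => h.2.2, fun h => ⟨le_rfl, Fin.zero_le _, h⟩⟩ rfl rfl
    have hsum1 : (∑ i' : Fin n, ∑ j' : Fin (n + 1),
        if (0 : Fin (n + 1)) ≤ i'.succ ∧ i'.succ ≤ j' ∧ j' ≤ j then e i'.succ j' else 0) =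
        ∑ a : Fin (n + 1), ∑ b : Fin (n + 1), if a < b ∧ b ≤ j then α a b else 0 := by
      rw [Fin.sum_univ_castSucc (fun a => ∑ b : Fin (n + 1), if a < b ∧ b ≤ j then α a b else 0)]
      rw [hlast (fun _ b => b ≤ j), add_zero]
      refine Finset.sum_congr rfl fun a _ => Finset.sum_congr rfl fun b _ => ?_
      rw [hes]
      refine if_congr ⟨fun h => ⟨?_, h.2.2⟩, fun h => ⟨Fin.zero_le _, ?_, h.2⟩⟩ rfl rfl
      · exact Fin.castSucc_lt_iff_succ_le.2 h.2.1
      · exact Fin.castSucc_lt_iff_succ_le.1 h.1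
    rw [hsum0, hsum1]
    simp only [Fin.val_zero, Nat.cast_zero, sub_zero]
    linarith
  | succ i₀ =>
    have hlt : i₀.castSucc < j := lt_of_lt_of_le Fin.castSucc_lt_succ hij
    have h := h1 i₀.castSucc j hlt
    have hsum0 : (∑ j' : Fin (n + 1),
        if i₀.succ ≤ 0 ∧ (0 : Fin (n + 1)) ≤ j' ∧ j' ≤ j then e 0 j' else 0) = 0 :=
      Finset.sum_eq_zero fun j' _ => if_neg fun h =>
        (Fin.succ_ne_zero i₀) (le_antisymm h.1 (Fin.zero_le _))
    have hsum1 : (∑ i' : Fin n, ∑ j' : Fin (n + 1),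
        if i₀.succ ≤ i'.succ ∧ i'.succ ≤ j' ∧ j' ≤ j then e i'.succ j' else 0) =
        ∑ a : Fin (n + 1), ∑ b : Fin (n + 1),
          if i₀.castSucc ≤ a ∧ a < b ∧ b ≤ j then α a b else 0 := by
      rw [Fin.sum_univ_castSucc (fun a => ∑ b : Fin (n + 1),
        if i₀.castSucc ≤ a ∧ a < b ∧ b ≤ j then α a b else 0)]
      have hl : (∑ b : Fin (n + 1), if i₀.castSucc ≤ Fin.last n ∧ Fin.last n < b ∧ b ≤ j
          then α (Fin.last n) b else 0) = 0 :=
        Finset.sum_eq_zero fun b _ => if_neg fun h => (not_lt.2 (Fin.le_last b)) h.2.1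
      rw [hl, add_zero]
      refine Finset.sum_congr rfl fun a _ => Finset.sum_congr rfl fun b _ => ?_
      rw [hes]
      refine if_congr ⟨fun h => ⟨?_, ?_, h.2.2⟩, fun h => ⟨?_, ?_, h.2.2⟩⟩ rfl rfl
      · exact Fin.castSucc_le_castSucc_iff.2 (Fin.succ_le_succ_iff.1 h.1)
      · exact Fin.castSucc_lt_iff_succ_le.2 h.2.1
      · exact Fin.succ_le_succ_iff.2 (Fin.castSucc_le_castSucc_iff.1 h.1)
      · exact Fin.castSucc_lt_iff_succ_le.1 h.2.1
    rw [hsum0, hsum1, zero_add]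
    have hv : ((i₀.succ : Fin (n + 1)) : ℤ) = (i₀.castSucc : Fin (n + 1)) + 1 := by
      simp only [Fin.val_succ, Fin.val_castSucc]; push_cast; ring
    rw [hv]
    linarith

/-- **Pull-back of a simplicial Laurent monomial.** In the cubical chart `t = cubicalMap x`
(`tᵢ = x₀ ⋯ xᵢ`) of the open ordered simplex, the monomial
`∏ tᵢ^{βᵢ} (1 - tᵢ)^{γᵢ} ∏_{i<j} (tᵢ - tⱼ)^{αᵢⱼ}` times the Jacobian `∏ⱼ xⱼ^{n-j}` is the cubical
atom `xᵃ ∏_{i ≤ j} (1 - xᵢ ⋯ xⱼ)^{e i j}` with `e 0 j = γⱼ`, `e (i+1) j = αᵢⱼ` and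
`aₘ = ∑_{l ≥ m} βₗ + ∑_{m ≤ l < l'} α_{l l'} + (n - m)`. -/
theorem pullback_eq (β γ : Fin (n + 1) → ℤ) (α : Fin (n + 1) → Fin (n + 1) → ℤ)
    (a : Fin (n + 1) → ℕ) (e : Fin (n + 1) → Fin (n + 1) → ℤ)
    (ha : ∀ m : Fin (n + 1), (a m : ℤ) = (∑ l : Fin (n + 1), if m ≤ l then β l else 0) +
      (∑ l : Fin (n + 1), ∑ l' : Fin (n + 1), if m ≤ l ∧ l < l' then α l l' else 0) +
        (((n + 1 : ℕ) : ℤ) - (m : ℤ)) - 1)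
    (he0 : ∀ j, e 0 j = γ j) (hes : ∀ (i : Fin n) (j : Fin (n + 1)), e i.succ j = α i.castSucc j)
    {x : Fin (n + 1) → ℝ} (hx : ∀ i, x i ∈ Ioo (0:ℝ) 1) :
    ((∏ i, TwoPosets.cubicalMap (n + 1) x i ^ β i) *
        (∏ i, (1 - TwoPosets.cubicalMap (n + 1) x i) ^ γ i) *
        ∏ i, ∏ j, if i < j then
          (TwoPosets.cubicalMap (n + 1) x i - TwoPosets.cubicalMap (n + 1) x j) ^ α i j
          else (1:ℝ)) *
      (∏ j, x j ^ (n + 1 - 1 - (j : ℕ))) =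
    (∏ i, x i ^ a i) *
      ∏ i, ∏ j, if i ≤ j then (1 - ∏ l, if i ≤ l ∧ l ≤ j then x l else 1) ^ e i j else (1:ℝ) := by
  have hPc : ∀ i, TwoPosets.cubicalMap (n + 1) x i = ∏ l with l ≤ i, x l := fun _ => rfl
  have hx0 : ∀ i, x i ≠ 0 := fun i => (hx i).1.ne'
  have hP0 : ∀ i : Fin (n + 1), (∏ l with l ≤ i, x l) ≠ 0 := fun i =>
    Finset.prod_ne_zero_iff.2 fun l _ => hx0 l
  simp only [hPc]
  -- (1) the `β`-factor
  have h1 : ∏ i, (∏ l with l ≤ i, x l) ^ β i =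
      ∏ m, x m ^ (∑ l : Fin (n + 1), if m ≤ l then β l else 0) := by
    have h := prod_pprod_zpow (fun i : Fin (n + 1) => i) β x hx0
    simp only [Finset.sum_filter] at h
    exact h
  -- (2) the `γ`-factor
  have h2 : ∏ i, (1 - ∏ l with l ≤ i, x l) ^ γ i =
      ∏ j, (1 - ∏ l, if (0 : Fin (n + 1)) ≤ l ∧ l ≤ j then x l else 1) ^ γ j :=
    Finset.prod_congr rfl fun j _ => by rw [cp_zero_eq]
  -- (3) the `α`-factor splits into a monomial part and a chordal part
  have h3 : (∏ i, ∏ j, if i < j then ((∏ l with l ≤ i, x l) - ∏ l with l ≤ j, x l) ^ α i j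
        else (1:ℝ)) =
      (∏ i, ∏ j, if i < j then (∏ l with l ≤ i, x l) ^ α i j else (1:ℝ)) *
        ∏ i' : Fin n, ∏ j : Fin (n + 1), if i'.succ ≤ j then
          (1 - ∏ l, if i'.succ ≤ l ∧ l ≤ j then x l else 1) ^ α i'.castSucc j else (1:ℝ) := by
    rw [Fin.prod_univ_castSucc (fun i => ∏ j,
        if i < j then ((∏ l with l ≤ i, x l) - ∏ l with l ≤ j, x l) ^ α i j else (1:ℝ)),
      Fin.prod_univ_castSucc (fun i => ∏ j,
        if i < j then (∏ l with l ≤ i, x l) ^ α i j else (1:ℝ))]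
    have hl1 : (∏ j : Fin (n + 1), if Fin.last n < j then
        ((∏ l with l ≤ Fin.last n, x l) - ∏ l with l ≤ j, x l) ^ α (Fin.last n) j
        else (1:ℝ)) = 1 :=
      Finset.prod_eq_one fun j _ => if_neg (not_lt.2 (Fin.le_last j))
    have hl2 : (∏ j : Fin (n + 1), if Fin.last n < j then
        (∏ l with l ≤ Fin.last n, x l) ^ α (Fin.last n) j else (1:ℝ)) = 1 :=
      Finset.prod_eq_one fun j _ => if_neg (not_lt.2 (Fin.le_last j))
    rw [hl1, hl2, mul_one, mul_one, ← Finset.prod_mul_distrib]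
    refine Finset.prod_congr rfl fun i' _ => ?_
    rw [← Finset.prod_mul_distrib]
    refine Finset.prod_congr rfl fun j _ => ?_
    by_cases hij : i'.castSucc < j
    · rw [if_pos hij, if_pos hij, if_pos (Fin.castSucc_lt_iff_succ_le.1 hij),
        pprod_sub_pprod i' j hij x, mul_zpow]
    · rw [if_neg hij, if_neg hij, if_neg (fun h => hij (Fin.castSucc_lt_iff_succ_le.2 h)),
        mul_one]
  -- (4) the monomial part of the `α`-factor
  have h4 : (∏ i, ∏ j, if i < j then (∏ l with l ≤ i, x l) ^ α i j else (1:ℝ)) =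
      ∏ m, x m ^ (∑ l : Fin (n + 1), ∑ l' : Fin (n + 1),
        if m ≤ l ∧ l < l' then α l l' else 0) := by
    have h4a : ∀ i : Fin (n + 1), (∏ j, if i < j then (∏ l with l ≤ i, x l) ^ α i j else (1:ℝ)) =
        (∏ l with l ≤ i, x l) ^ (∑ l' : Fin (n + 1), if i < l' then α i l' else 0) := by
      intro i
      rw [← Finset.sum_filter, zpow_finset_sum _ _ (hP0 i), ← Finset.prod_filter]
    simp only [h4a]
    have h := prod_pprod_zpow (fun i : Fin (n + 1) => i)
      (fun i => ∑ l' : Fin (n + 1), if i < l' then α i l' else 0) x hx0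
    simp only [Finset.sum_filter] at h
    rw [h]
    refine Finset.prod_congr rfl fun m _ => ?_
    congr 1
    refine Finset.sum_congr rfl fun l _ => ?_
    by_cases hml : m ≤ l
    · simp only [hml, true_and, if_true]
    · simp only [hml, false_and, if_false, Finset.sum_const_zero]
  -- (5) the chord product of `e`
  have h5 : (∏ i, ∏ j, if i ≤ j then (1 - ∏ l, if i ≤ l ∧ l ≤ j then x l else 1) ^ e i j
        else (1:ℝ)) =
      (∏ j, (1 - ∏ l, if (0 : Fin (n + 1)) ≤ l ∧ l ≤ j then x l else 1) ^ γ j) *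
        ∏ i' : Fin n, ∏ j : Fin (n + 1), if i'.succ ≤ j then
          (1 - ∏ l, if i'.succ ≤ l ∧ l ≤ j then x l else 1) ^ α i'.castSucc j else (1:ℝ) := by
    rw [Fin.prod_univ_succ (fun i => ∏ j,
      if i ≤ j then (1 - ∏ l, if i ≤ l ∧ l ≤ j then x l else 1) ^ e i j else (1:ℝ))]
    congr 1
    · exact Finset.prod_congr rfl fun j _ => by rw [if_pos (Fin.zero_le _), he0]
    · exact Finset.prod_congr rfl fun i' _ => Finset.prod_congr rfl fun j _ => by rw [hes]
  -- (6) the exponents of `x`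
  have h6 : ∀ m, x m ^ a m = x m ^ (∑ l : Fin (n + 1), if m ≤ l then β l else 0) *
      x m ^ (∑ l : Fin (n + 1), ∑ l' : Fin (n + 1), if m ≤ l ∧ l < l' then α l l' else 0) *
        x m ^ (n + 1 - 1 - (m : ℕ)) := by
    intro m
    have hm := m.isLt
    have hAm : ((a m : ℕ) : ℤ) = (∑ l : Fin (n + 1), if m ≤ l then β l else 0) +
        (∑ l : Fin (n + 1), ∑ l' : Fin (n + 1), if m ≤ l ∧ l < l' then α l l' else 0) +
          ((n + 1 - 1 - (m : ℕ) : ℕ) : ℤ) := by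
      rw [ha]; omega
    rw [← zpow_natCast (x m) (a m), hAm, zpow_add₀ (hx0 m), zpow_add₀ (hx0 m), zpow_natCast]
  have h6' : ∏ m, x m ^ a m = (∏ m, x m ^ (∑ l : Fin (n + 1), if m ≤ l then β l else 0)) *
      (∏ m, x m ^ (∑ l : Fin (n + 1), ∑ l' : Fin (n + 1),
        if m ≤ l ∧ l < l' then α l l' else 0)) *
        ∏ m : Fin (n + 1), x m ^ (n + 1 - 1 - (m : ℕ)) := by
    rw [← Finset.prod_mul_distrib, ← Finset.prod_mul_distrib]
    exact Finset.prod_congr rfl fun m _ => h6 m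
  -- assembly
  rw [h2, h3, h4, h1, h5, h6']
  ring

end MonomialConvergence

/-! ### The stub -/

open MzvKernelInKZ AtomReduction in
/-- **Stub `stub_monomialConvergence`** (Brown's convergence criterion on the open ordered simplex,
sufficiency). If the three families of block inequalities hold — inner blocks `{tᵢ, …, tⱼ}`:
`Σ_{i≤a<b≤j} α_{ab} + (j - i + 1) - 2 ≥ 0`; blocks through `1`:
`Σ_{a≤j} γ_a + Σ_{a<b≤j} α_{ab} + (j + 1) - 1 ≥ 0`; blocks through `0`:
`Σ_{a≥i} β_a + Σ_{i≤a<b} α_{ab} + (k - i) - 1 ≥ 0` — then the simplicial Laurent monomial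
`q · ∏ tᵢ^{βᵢ} (1 - tᵢ)^{γᵢ} ∏_{i<j} (tᵢ - tⱼ)^{αᵢⱼ}` is absolutely integrable on
`{1 > t₀ > ⋯ > t_{k-1} > 0}`. Proof: in the cubical chart `tᵢ = x₀ ⋯ xᵢ`
(`AtomReduction.integrableOn_simplex_iff`) the integrand times the Jacobian is a cubical atom
(`MonomialConvergence.pullback_eq`) whose exponents of `x` are the (non-negative) block sums
through `0` and whose interval conditions are the two other families
(`MonomialConvergence.interval_condition`); conclude by the cubical criterion `atomConvergence`.
F. Brown, Ann. Sci. ENS 42 (2009), §7. [cite: BrownENS2009, §7 Lemma 7.2] -/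
theorem stub_monomialConvergence : ∀ (k : ℕ) (q : ℚ) (β γ : Fin k → ℤ) (α : Fin k → Fin k → ℤ), (∀ i j : Fin k, i < j → 0 ≤ (∑ a : Fin k, ∑ b : Fin k, if i ≤ a ∧ a < b ∧ b ≤ j then α a b else 0) + ((j : ℤ) - (i : ℤ) + 1) - 2) → (∀ j : Fin k, 0 ≤ (∑ a : Fin k, if a ≤ j then γ a else 0) + (∑ a : Fin k, ∑ b : Fin k, if a < b ∧ b ≤ j then α a b else 0) + ((j : ℤ) + 1) - 1) → (∀ i : Fin k, 0 ≤ (∑ a : Fin k, if i ≤ a then β a else 0) + (∑ a : Fin k, ∑ b : Fin k, if i ≤ a ∧ a < b then α a b else 0) + ((k : ℤ) - (i : ℤ)) - 1) → MeasureTheory.IntegrableOn (fun t : Fin k → ℝ => (q : ℝ) * ((∏ i : Fin k, t i ^ β i) * (∏ i : Fin k, (1 - t i) ^ γ i) * ∏ i : Fin k, ∏ j : Fin k, if i < j then (t i - t j) ^ α i j else 1)) {t : Fin k → ℝ | (∀ i, 0 < t i) ∧ (∀ i, t i < 1) ∧ StrictAnti t} MeasureTheory.volume := by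
  intro k q β γ α h1 h2 h3
  cases k with
  | zero =>
    have : IsFiniteMeasure (volume : Measure (Fin 0 → ℝ)) := by
      rw [volume_pi, Measure.pi_of_empty]; infer_instance
    simp only [Finset.univ_eq_empty, Finset.prod_empty, mul_one]
    exact integrableOn_const
  | succ n =>
    obtain ⟨e, he0, hes⟩ : ∃ e : Fin (n + 1) → Fin (n + 1) → ℤ, (∀ j, e 0 j = γ j) ∧
        ∀ (i : Fin n) (j : Fin (n + 1)), e i.succ j = α i.castSucc j :=
      ⟨Fin.cons γ fun i => α i.castSucc, fun j => by simp, fun i j => by simp⟩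
    obtain ⟨a, ha⟩ : ∃ a : Fin (n + 1) → ℕ, ∀ m : Fin (n + 1), (a m : ℤ) =
        (∑ l : Fin (n + 1), if m ≤ l then β l else 0) +
          (∑ l : Fin (n + 1), ∑ l' : Fin (n + 1), if m ≤ l ∧ l < l' then α l l' else 0) +
            (((n + 1 : ℕ) : ℤ) - (m : ℤ)) - 1 :=
      ⟨fun m => ((∑ l : Fin (n + 1), if m ≤ l then β l else 0) +
          (∑ l : Fin (n + 1), ∑ l' : Fin (n + 1), if m ≤ l ∧ l < l' then α l l' else 0) +
            (((n + 1 : ℕ) : ℤ) - (m : ℤ)) - 1).toNat,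
        fun m => Int.toNat_of_nonneg (h3 m)⟩
    have hcube := (atomConvergence (n + 1) 1 a e one_ne_zero).2
      (MonomialConvergence.interval_condition γ α e he0 hes h1 h2)
    rw [show {t : Fin (n + 1) → ℝ | (∀ i, 0 < t i) ∧ (∀ i, t i < 1) ∧ StrictAnti t} =
        Negative.simplex (n + 1) from rfl, integrableOn_simplex_iff]
    refine IntegrableOn.congr_fun (hcube.const_mul (q : ℝ)) (fun x hx => ?_) (measurableSet_cube _)
    simp only [Rat.cast_one, one_mul]
    rw [← MonomialConvergence.pullback_eq β γ α a e ha he0 hes hx]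
    exact (mul_assoc _ _ _).symm

end Summit.KontsevichZagierPeriods.DihedralNormalForm.TorusDescent

end
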